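import Literature.Computability.Complexity.FournierKoiranTransfer
import Literature.Computability.Complexity.FKProtocolDriver
import Literature.Computability.Complexity.FKFinalCheck
import HarnessLib

/-!
# Fournier–Koiran 2000: Theorem 3 from Theorem 2 (point location by an `NP`/sign protocol)

Topic `Literature/Computability/Complexity`; companion of `FournierKoiranTransfer.lean` (the named
fact `fournierKoiran2000_NDPAdd_subset_PAddRelClass_NP`, Fournier–Koiran's Thm 3:
`NDP⁰_ℝovs ⊆ P⁰_ℝovs(NP)` in the sign-oracle rendering). The printed proof (ICALP 2000 = LIP
RR-1999-21, pp. 4–12) has two parts: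

1. **Theorem 2** (p. 4, proved in §§2.1–2.4): *point location* — a parameter-free polynomial-time
   machine over `ℝ_ovs` with a Boolean `NP` oracle locates the input `x ∈ ℝⁿ` in the arrangement
   `𝒜(ℋₙ)` of all hyperplanes with integer coefficients of polynomial bit-size (binary search, `NP`
   prefix searches for the chains `E_i` and apexes `s_n^k`, §2.1; polynomial size of the objects,
   §2.2; homogenisation, §2.3; a rational point of the located face, §2.4 / Prop. 1);
2. **the final `NP` question** (pp. 11–12): at a rational point `q ∈ P_S` with small coordinates,
   membership of the whole face in `L` is ONE Boolean `NP` query (guess the digital witness and run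
   the real machine on `⟨q, z⟩`).

Part 2 and the whole machine side are PROVED in the tree: `FKFinalCheck` (`FinalCheck M q T ∈ NP`,
`mem_FinalCheck_iff_of_agree`), `FKProtocolDriver` (`mem_PAddRelClass_NP_of_protocol`: every
polynomial one-bit protocol with `NP` and sign questions runs in `P⁰_ℝovs(NP)` — "tedious but
completely straightforward", report p. 4), `FournierKoiranTransferOracle` (query-length bound
`exists_query_length_bound`, Remark 1). The location protocol of §2 itself is being built in
`FKPointLocation*` (protocol `FKPointLocationProtocol`, its validity `…ProtocolValid`, the `NP`
certificates `…NPChecks`, the rational point `…XStar`, sizes and codes `…Sizes/Codes/Encoding/FormsFP`).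
This file names part 1 — Theorem 2 in the protocol rendering — as a fact and PROVES Thm 3 from it:

* `fournierKoiran2000_pointLocation_protocol` — Theorem 2: for every polynomial bit-size bound `T`
  there is a polynomial one-bit protocol (poly-time selector and probes, `NP` statements) with a
  poly-time read-out producing, against the sign oracle of any `x ∈ ℝⁿ`, a rational point `N/d` on
  which every sign query of length `≤ T(n)` has the same answer as on `x`;
* `fournierKoiran2000_NDPAdd_subset_PAddRelClass_NP_holds_of` — the assembly (Thm 3, p. 11).

## References

* [FournierKoiran2000] H. Fournier, P. Koiran, *Lower bounds are not easier over the reals: inside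
  PH*, ICALP 2000, LNCS 1853, 832–843 = LIP RR-1999-21: Thm 2 (p. 4), §§2.1–2.4, Prop. 1, Thm 3
  and its proof (pp. 10–12).
-/

noncomputable section

namespace Literature.Computability.Complexity

open _root_.Computability Polynomial CodeFP Brick FKTransfer

/-- **Fournier–Koiran 2000, Theorem 2 (point location in `FP⁰_ℝovs(NP)`), protocol rendering.**
Printed (report p. 4): "Theorem 2. The location problem for `𝒜(ℋₙ)` is in `FP⁰_ℝovs(NP)`", where
`ℋₙ` is the set of hyperplanes of `ℝⁿ` with integer coefficients bounded by `2^{t(n)}` (Remark 1: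
all tests of a time-`t(n)` parameter-free machine are of this form) and locating `x` means computing
a system `S` of equations/strict inequalities from `ℋₙ` whose solution set `P_S ∋ x` lies inside one
face of `𝒜(ℋₙ)`; by §2.4 / Prop. 1 (and §2.3, `x_{n+1} = 1`) one then has a rational point of `P_S`
with polynomial-size coordinates. Tree form, over the one-bit protocols of `FKProtocolDriver`
(selector `isNP`, probes `qry`, `NP` statements `Lnp`, answer stream `FKTransfer.answers` against the
sign environment `signEnv x`): for every polynomial `T` there are polynomials `m`, `K`, a
polynomial-time selector and probe code (`CodeFP`, probes of length `m(n)`), an `NP` language `Lnp`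
of statements and a polynomial-time read-out `pt ∈ FP` such that for every `n` and `x ∈ ℝⁿ` the
read-out of the `K(n)` answers is the code `⟨1ⁿ, ratCode d N⟩` of a rational point `N/d` (`d > 0`)
at which EVERY sign query of length `≤ T(n)` (an integer affine form with coefficients
`< 2^{T(n)+1}`, `natAbs_of_decode_listBool_lt`) has the same answer as at `x` — i.e. `N/d` lies in
the face of `x` in `𝒜(ℋₙ)`. (The prover will take `N` of length `n`; the protocol is that of
`FKPointLocationProtocol`, its `NP` statements are certified in `FKPointLocationNPChecks`, the point
is `FKPointLocationXStar`, the sign agreement is `Cert.sign_lin_xStar_eq` with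
`affine_sign_agree_of_homogeneous` / `signOracle_eq_of_sign_agree`.)
[cite: FournierKoiran2000, Thm 2 (report p. 4) with §§2.1–2.4 and Prop. 1] -/
def fournierKoiran2000_pointLocation_protocol : Prop :=
  ∀ T : Polynomial ℕ, ∃ (m K : Polynomial ℕ) (isNP : ℕ → List Bool → Bool)
    (qry : ℕ → List Bool → List Bool) (Lnp : Language Bool) (pt : List Bool → List Bool),
    CodeFP (pairE unE strE) bitE (fun p => isNP p.1 p.2) ∧
    CodeFP (pairE unE strE) strE (fun p => qry p.1 p.2) ∧
    (∀ n prev, (qry n prev).length = m.eval n) ∧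
    Lnp ∈ Nondeterministic.NP ∧ pt ∈ FP ∧
    ∀ (n : ℕ) (x : Fin n → ℝ), ∃ (d : ℕ) (N : List ℤ), 0 < d ∧
      pt (boolPair (unaryEncodeNat n) (answers isNP qry Lnp (signEnv x) n (K.eval n))) =
        boolPair (unaryEncodeNat n) (ratCode d N) ∧
      ∀ w : List Bool, w.length ≤ T.eval n → signOracle x w = signOracle (ratPoint d N) w

/-- **Assembly (Fournier–Koiran 2000, proof of Thm 3, report pp. 11–12): `NDP⁰_ℝovs ⊆ P⁰_ℝovs(NP)`
from point location.** Given `L ∈ NDPAdd` with verifier `M` (budget `q`), bound the length of the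
verifier's sign queries by a polynomial `T` (`exists_query_length_bound`, Remark 1), locate the
input with the protocol of `fournierKoiran2000_pointLocation_protocol` at precision `T`, and take as
verdict the `NP` language `pt ⁻¹' FinalCheck M q T` ("is some digital witness accepted at the
rational point?", `FinalCheck_mem_NP`, `preimage_mem_NP`); by the sign agreement the verdict is
membership of `x` (`mem_FinalCheck_iff_of_agree`), and `mem_PAddRelClass_NP_of_protocol` runs the
protocol in `P⁰_ℝovs(NP)`. [cite: FournierKoiran2000, Thm 3 (proof, report pp. 11–12)] -/
theorem fournierKoiran2000_NDPAdd_subset_PAddRelClass_NP_holds_of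
    (hloc : fournierKoiran2000_pointLocation_protocol) :
    fournierKoiran2000_NDPAdd_subset_PAddRelClass_NP := by
  intro L hL
  obtain ⟨M, hM, q, hLq⟩ := hL
  obtain ⟨T, hT⟩ := FKPointLocation.exists_query_length_bound M hM q
  obtain ⟨m, K, isNP, qry, Lnp, pt, hisNP, hqry, hqlen, hLnp, hpt, hrun⟩ := hloc T
  have hLfin : pt ⁻¹' FKTransfer.FinalCheck M q T ∈ Nondeterministic.NP :=
    preimage_mem_NP (FKTransfer.FinalCheck_mem_NP hM) hpt
  refine FKTransfer.mem_PAddRelClass_NP_of_protocol m K hisNP hqry hqlen hLnp hLfin fun n x => ?_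
  obtain ⟨d, N, hd, hpteq, hagree⟩ := hrun n x
  refine (hLq n x).trans ((mem_FinalCheck_iff_of_agree hT hd N n x ?_).symm.trans ?_)
  · exact fun y hy ans hans hlt w hw => hagree w (hT n y hy ans hans hlt.le w hw)
  · rw [← hpteq]
    exact Iff.rfl

end Literature.Computability.Complexity

end
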